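import Summits.CriticalPhenomena.PercolationContinuityZ3.Theorems.PercNearOneGluingNoHeavyLowerTailSahiSlotTensorCone

/-!
# The order-1 row of the tensor-cone table: `LitProdCert d 1` for every `d` (the `x_⊥` certificate)

Support file of the one-cut programme (crux `NoHeavyLowerTail`, stmt-CriticalPhenomena-4575; cell `prim-masterthm`, seat P3, gen 22;
`run/shared/lean/prim/prim-masterthm/prim-masterthm-p3/HIERARCHY.md` §30).  Pure, no definitions, standard axioms.  Bookkeeping: at order 1
the slot cube `Q d 1` is a single point and `patternForm d 1 (h) = h_0(⊥)` (`patternForm_one_eq`), which is the literal `x_⊥` — so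
**`litProdCert_order_one : ∀ d, LitProdCert d 1`**.  With `…SahiSlotTensorConeOrderTwo` (`n = 2`, all `d`), `…TensorConeDimOne` (`d = 1`, all `n`)
and `litProdCert_three_iff` (`n = 3` iff `d ≤ 2`) this completes the settled part of the table.  HONEST LABEL: trivial row, recorded for the table. [this work]
-/

noncomputable section

namespace Summit.CriticalPhenomena.PercolationContinuityZ3.Theorems

open Finset Function
open Literature.Combinatorics.Sahi2008 Literature.Combinatorics.Sahi2008.CycleForm

namespace SahiSlot

section OrderOne

variable {d : ℕ}

/-- At order 1 the pattern functional is the value at the (unique) point of the slot cube. [this work] -/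
theorem patternForm_one_eq (h : Fin 1 → Q d 1 → ℝ) : patternForm d 1 h = h 0 (fun _ => 0) := by
  unfold patternForm diagForm
  rw [Fintype.sum_subsingleton _ (fun _ => (1 : Equiv.Perm (Fin 1))), Fintype.sum_subsingleton _ (1 : Equiv.Perm (Fin 1))]
  have hcard : (orbits (1 : Equiv.Perm (Fin 1))).card = 1 := by
    refine le_antisymm ?_ (card_pos.2 ⟨_, orbit_mem_orbits (1 : Equiv.Perm (Fin 1)) 0⟩)
    calc (orbits (1 : Equiv.Perm (Fin 1))).card ≤ (univ : Finset (Fin 1)).card := Finset.card_image_le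
      _ = 1 := by simp
  rw [hcard, Nat.sub_self, pow_zero, one_mul, Fin.prod_univ_one]
  simp only [comp_apply]
  congr 1

/-- **`LitProdCert d 1` for every `d`**: the order-1 pattern functional is the single literal `x_⊥`. [this work] -/
theorem litProdCert_order_one (d : ℕ) : LitProdCert d 1 := by
  refine ⟨1, fun _ => 1, fun _ _ => Lit.bot, fun _ => zero_le_one, fun U _ => ?_⟩
  rw [patternForm_one_eq, Fin.sum_univ_one, one_mul, Fin.prod_univ_one]
  show setInd (U 0) (fun _ => 0) = (if h : 0 < 1 then setInd (U 0) (fun _ => ⟨0, h⟩) else 0)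
  rw [dif_pos Nat.one_pos]
  rfl

end OrderOne

end SahiSlot

end Summit.CriticalPhenomena.PercolationContinuityZ3.Theorems
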